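import Summits.NavierStokesRegularity.NavierStokesRegularity.Theses.CoriolisHead
import Summits.NavierStokesRegularity.NavierStokesRegularity.Theorems.CoriolisHeadNoCoRotatingCoreReduction
import Summits.NavierStokesRegularity.NavierStokesRegularity.Theorems.CoriolisHeadFarFieldCovarianceFrame
import Literature.Analysis.FluidPDE.TsaiLocalEnergy
import HarnessLib.Audit

/-!
# Line `local_energy_rescue` — crux `CoriolisHead.NoCoRotatingCore` (stmt-NavierStokesRegularity-22676)

**ns-idea-10 generation 3 (lens «rescuer»), 2026-08-28; v2.1 = v2 + V31b price P5 (S3a docstring: almost-monotonicity identity for `hgrad`); v2 = critic idea-crit-8 V31 (PASS-WITH-PRICE) prices P2 (S3 SPLIT into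
S3a `stub_localEnergyClass` + S3b `stub_decayOfTopNull`, glued by the PROVED `typeIDecay_of`) and P3 (S1 by the harmonic-gradient route) paid.
A LINE, not a route: no summit, no `NoCoRotatingCore`, no
`SpiralScalingLiouville` is proved here.**  Card: `Lines/local_energy_rescue.md`; idea: `Ideas/local-energy-rescue.md`.

DEATH DODGED (recorded on this crux): «bounded ⇒ decaying is false» (the constants `U ≡ b`, `P` affine are bounded rotated
profiles) and the open XL node K1a of line `far_field_constancy` (scale-natural DERIVATIVE decay; "a transported non-decaying
far-field pattern" is why it might fail).  THE DODGE, as explicit stubs: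

* **S1 `stub_driftNormalForm`** (in print: Koch–Nadirashvili–Seregin–Šverák 2009 §5 / Seregin 2014 Lemma 6.5, Thm 2.6,
  Remark 6.3 — the pressure of a bounded ancient solution is `RᵢRⱼ(uᵢuⱼ) + b′(t)·x + c(t)`): recentring by the SYMMETRY
  `U ↦ U(· + y₀) − b` of the profile system (`a•y₀ − B y₀ = −b`; landed `farField_translationCovariance`) one reaches a profile
  whose pressure has bounded mean oscillation (`BMO₂`: `∫_{B_ρ(z)} |P′ − m|² ≤ K ρ³`).  This kills the constants BY SYMMETRY
  (a constant `V ≡ d ≠ 0` has pressure `−⟨(aI+B)d, y⟩ ∉ BMO`), not by hypothesis.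
* **S2 `stub_densityBootstrap`** (NEW, elementary): the local energy identity of the PHYSICAL rotated self-similar field
  `u(t,x) = λ e^{θB} V(λ e^{−θB} x)`, `λ = (2a(T−t))^{−1/2}`, `θ = a⁻¹ log λ`, against a TIME-INDEPENDENT cutoff on `B_{2r}(x₀)`,
  bounded using only `|V| ≤ M` and `BMO₂` of the pressure, improves the energy density `F(ρ) = sup_z ∫_{B_ρ(z)}|V|²` from the
  trivial `Kρ³` to `Kρ^{3−β}` with `β > 1` (two rounds: `β = 1`, then `β = 3/2`).
* **S3 `stub_typeIDecayOfLocalEnergy`** (Tsai 1998 §4 TRANSPLANTED from `α = 0` with the local-energy HYPOTHESIS to `α ≠ 0`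
  with the local-energy class DERIVED): `BMO₂` + density `β > 1` ⇒ (identification `P′ = RᵢRⱼ(VᵢVⱼ) + m`, Calderón–Zygmund
  near/far split, one more round of the identity) `(u, p − c(t))` lies in Caffarelli–Kohn–Nirenberg's class on the cylinder
  `Q₁(T, 0)` UP TO THE TOP ⇒ the tree-PROVED `Literature.Analysis.FluidPDE.tsai1998_top_singular_null_holds` gives
  `μH[1]`-nullity of the top singular set ⇒ ROTATING Corollary 4.3: if `sup |y||V(y)| = ∞` then EVERY sphere `|x| = σ ∈ (0,1)`
  carries a top singular point, and the 1-Lipschitz radial map `x ↦ |x|` gives `μH[1] ≥ 1` (Mathlib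
  `LipschitzWith.hausdorffMeasure_image_le`) — no spiral geometry — contradiction; hence `|V(y)| ≤ K′/(1+|y|)`.
* **R1 `stub_pineauVicolConjecture`** (DECLARED RESIDUAL, verbatim from line `far_field_constancy` v2 = Pineau–Vicol
  Conjecture 1.1 AS PRINTED, arXiv:2607.09619): decaying rotated profiles vanish; general frame by the landed
  `decayingRotatedLiouville_of_pineauVicolFrame`.

COMPOSITION (kernel-checked, `sorry` only inside the four `stub_*`): `rotatedProfileLiouville_of` (S1, S2, S3, general-frame R1 ⟹
bounded rotated-profile Liouville `X`) and `NoCoRotatingCore_of : CoriolisHead.NoCoRotatingCore` through the landed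
`noCoRotatingCore_iff_rotatedProfileLiouville`.  WHAT IT BUYS if S1–S3 land: `NoCoRotatingCore ↔ (Conj. 1.1 as printed)` becomes a
THEOREM (today: K1 ∧ Conj 1.1 ⇒ NoCoRotatingCore with K1a XL open), and — with the tree fact `pineauVicol2026_rss_liouville` —
bounded rotated profiles at extreme rotation rates are constant WITHOUT a decay hypothesis.

This file is NOT registered with `ledger skeleton check` (KEY-NS #87 (2): the LEAD's skeleton of record on this crux is
`Lines/far_field_constancy.lean` v2); it is a crux workfile + evidence.
-/

noncomputable section

open Set Filter Topology MeasureTheory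
open scoped RealInnerProductSpace BigOperators NNReal ENNReal
open Literature.Analysis.FluidPDE

namespace Summit.NavierStokesRegularity.NavierStokesRegularity.Cruxes.NoCoRotatingCore.LocalEnergyRescue

open Summit.NavierStokesRegularity.NavierStokesRegularity.Theses
open Summit.NavierStokesRegularity.NavierStokesRegularity.Theorems.CoriolisHead

set_option linter.unusedVariables false
set_option linter.dupNamespace false

local notation "E3" => EuclideanSpace ℝ (Fin 3)

/-- **stub S1 — `stub_driftNormalForm` (support-in-print; L in Lean).**  Every bounded smooth rotated self-similar profile can be
RECENTRED by the symmetry `U ↦ U(· + y₀) − b` of the profile system to a bounded profile whose pressure has bounded mean oscillation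
(`BMO₂`): for some pressure `P'` of the recentred profile, `∀ z ρ, ∃ m, ∫_{B_ρ(z)} (P' − m)² ≤ K ρ³`.  In print: KNSS 2009 §5 /
Seregin 2014 Lemma 6.5 (`q_F = RᵢRⱼFᵢⱼ ∈ BMO`, `‖q_F‖_BMO ≤ c‖F‖_∞`, Stein) + Thm 2.6 / Remark 6.3 (pressure of a bounded ancient
solution `= p_{u⊗u} + b′(t)·x + c(t)`), applied to the rotated self-similar solution; the affine part `b′·x` is self-similar, hence
`⟨ℓ, y⟩` in profile variables, and is removed by the translation with `(aI + B) b = −ℓ`-bookkeeping (`aI ± B` invertible for skew `B`).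
THE PROOF TO USE (critic V31 P3 — self-contained, no mildness / KNSS normal form assumed; KNSS §5 / Seregin only as anchors): `H := P − N[U]` is harmonic (div(BU − (By·∇)U) = 0 for skew B, div((y·∇)U) = 0 for div-free U); ball averages of `∇P` at scale `R = |z|` are `O(1)` by integrating the
profile equation by parts (no derivative bounds needed), those of `∇N` are `O(‖N‖_BMO / R)`; so `∇H` is a harmonic function of
sublinear… in fact bounded averaged growth ⇒ `H` affine.  Why it might fail: it should not (printed theorem + linear algebra); Lean
cost is the Calderón–Zygmund `L^∞ → BMO` bound (tree: `RieszPressure*`, `BoundedMildWeakL3RieszPressure`, `NecasRuzickaSverakRiesz`).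
Sources: KochNadirashviliSereginSverak2009 §5; Seregin2014 book L.6.5/Thm 2.6/Rem 6.3; tree `farField_translationCovariance`.
[status: open] -/
theorem stub_driftNormalForm :
    ∀ (ν a : ℝ), 0 < ν → 0 < a → ∀ (B : E3 →L[ℝ] E3) (U : E3 → E3) (P : E3 → ℝ),
      ContDiff ℝ (⊤ : ℕ∞) U → ContDiff ℝ 2 P → (∀ x, inner ℝ (B x) x = 0) →
      Literature.Analysis.FluidPDE.VectorCalculus.IsDivFree U →
      (∀ y, -(ν • Laplacian.laplacian U y) + a • U y + a • fderiv ℝ U y y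
        + (B (U y) - fderiv ℝ U y (B y)) + Literature.Analysis.FluidPDE.convect U U y
        + gradient P y = 0) →
      (∃ M : ℝ, ∀ y, ‖U y‖ ≤ M) →
      ∃ (y₀ b : E3) (P' : E3 → ℝ) (K : ℝ),
        ContDiff ℝ (⊤ : ℕ∞) (fun y => U (y + y₀) - b) ∧ ContDiff ℝ 2 P' ∧
        Literature.Analysis.FluidPDE.VectorCalculus.IsDivFree (fun y => U (y + y₀) - b) ∧
        (∀ y, -(ν • Laplacian.laplacian (fun y => U (y + y₀) - b) y) + a • (fun y => U (y + y₀) - b) y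
          + a • fderiv ℝ (fun y => U (y + y₀) - b) y y
          + (B ((fun y => U (y + y₀) - b) y) - fderiv ℝ (fun y => U (y + y₀) - b) y (B y))
          + Literature.Analysis.FluidPDE.convect (fun y => U (y + y₀) - b) (fun y => U (y + y₀) - b) y
          + gradient P' y = 0) ∧
        (∃ M' : ℝ, ∀ y, ‖(fun y => U (y + y₀) - b) y‖ ≤ M') ∧
        (∀ (z : E3) (ρ : ℝ), 0 < ρ → ∃ m : ℝ, ∫ y in Metric.ball z ρ, (P' y - m) ^ 2 ≤ K * ρ ^ 3) := by
  sorry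

/-- **stub S2 — `stub_densityBootstrap` (crux of the line, rank 2; NEW; M/L).**  A bounded profile with `BMO₂` pressure has
SUB-VOLUME energy density: `∫_{B_ρ(z)} |U|² ≤ K₂ ρ^{3−β}` for some `β > 1`, all `ρ ≥ 1`, uniformly in the centre `z`.  Mechanism: the
local energy identity of the physical rotated self-similar field `u(t,x) = λ e^{θB} U(λ e^{−θB} x)` (`λ = (2a(T−t))^{−1/2}`,
`θ = a⁻¹ log λ`, pressure `λ² P`) against a TIME-INDEPENDENT cutoff `φ` on `B_{2r}(x₀)`: with `F(ρ) = sup_z ∫_{B_ρ(z)}|U|²` the four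
right-hand terms obey `T1 ≤ F(2r)`, `T2 ≤ ν C r⁻² ∫ λ⁻¹ F(2rλ) dτ`, `T3 ≤ (CM/r) ∫ F(2rλ) dτ`, `T4 ≤ (C/r)·C M² ∫ (rλ)^{3/2} F(2rλ)^{1/2} dτ`
(T4 uses ONLY `‖P − m_B‖_{L²(B)} ≤ C M² |B|^{1/2}` and `∫ m_B u·∇φ = 0`), while the left side dominates `λ⁻¹ ∫_{B_{rλ}(z)} |U|²` for
EVERY centre `z` (choose `x₀ = e^{θB} z / λ`); `F ≤ Kρ³` improves to `Kρ²`, then to `Kρ^{3/2}`.  Why it might fail: an arithmetic slip in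
the `T4` exponent bookkeeping (each round must gain a power, the bootstrap from `BMO₂` alone saturates at `β → 2⁻`, so `β > 1` is what is
claimed, not `β = 2`); the identity needs the physical field to be a classical solution on `(−∞,T) × ℝ³` (tree:
`isClassicalNSSolutionOn_pvAnsatz_of_profile` for the normal form).  Sources: CaffarelliKohnNirenberg1982 §2 (local energy
inequality); Tsai1998 (1.4); ChaeWolf2017 (arXiv:1610.09464) §2 (2.4) — the `L^p`, `p < ∞` version of this step. [status: open] -/
theorem stub_densityBootstrap :
    ∀ (ν a : ℝ), 0 < ν → 0 < a → ∀ (B : E3 →L[ℝ] E3) (U : E3 → E3) (P : E3 → ℝ),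
      ContDiff ℝ (⊤ : ℕ∞) U → ContDiff ℝ 2 P → (∀ x, inner ℝ (B x) x = 0) →
      Literature.Analysis.FluidPDE.VectorCalculus.IsDivFree U →
      (∀ y, -(ν • Laplacian.laplacian U y) + a • U y + a • fderiv ℝ U y y
        + (B (U y) - fderiv ℝ U y (B y)) + Literature.Analysis.FluidPDE.convect U U y
        + gradient P y = 0) →
      (∃ M : ℝ, ∀ y, ‖U y‖ ≤ M) →
      ∀ K : ℝ,
      (∀ (z : E3) (ρ : ℝ), 0 < ρ → ∃ m : ℝ, ∫ y in Metric.ball z ρ, (P y - m) ^ 2 ≤ K * ρ ^ 3) →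
      ∃ (β K₂ : ℝ), 1 < β ∧
        (∀ (z : E3) (ρ : ℝ), 1 ≤ ρ → ∫ y in Metric.ball z ρ, ‖U y‖ ^ 2 ≤ K₂ * ρ ^ (3 - β)) := by
  sorry

/-- **stub S3a — `stub_localEnergyClass` (v2 split of S3, critic V31 P2; L/XL — carries the Calderón–Zygmund cost).**  A bounded profile with
`BMO₂` pressure and sub-volume energy density `β > 1` has (i) LINEAR energy density `∫_{B_ρ(z)}|U|² ≤ K₃ ρ` (`β = 2`: identification
`P = RᵢRⱼ(UᵢUⱼ) + m`, CZ near/far split, one more round of S2's identity with all four terms finite), and (ii) its PHYSICAL rotated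
self-similar field `u(t,x) = λ e^{θB} U(λ e^{−θB} x)`, `λ = (2a(0−t))^{−1/2}`, `θ = a⁻¹ log λ` (blow-up time 0; the explicit `fun t x ↦ …` is a
hypothesis `u = …` so provers get the name `u`), with SOME pressure `p` (the physical `λ²P(λe^{−θB}x)` minus `c(t)`), lies in Caffarelli–Kohn–
Nirenberg's class on the cylinder `Q₁(0,0)` UP TO THE TOP in EXACTLY the hypothesis structure of the tree fact
`Literature.Analysis.FluidPDE.tsai1998_top_singular_null` (ρ = 1, T = 0, x₀ = 0): `IsSuitableWeakSolutionOn (parabolicCylinderOpens 1 (0,0)) ν 0 u p`,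
`henergy` (ess-bounded `∫_{B₁}|u(t)|²` for a.e. `t ∈ (−1,0)`), `hgrad` (weak spatial gradient in `L²(Q₁)`), `hp` (`p ∈ L^{3/2}(Q₁)`).  Interface
risk of the line (critic): the packaging must match that structure verbatim — it does here by construction (the four conjuncts are copied from the
fact's binders).  Why it might fail: the `L^{3/2}(Q₁(0,0))` pressure bound at the ORIGIN-containing cylinder needs `β > 1` genuinely (near part
`‖N_near‖_{3/2} ≲ ‖U‖²_{L³}`) and the enstrophy bound `hgrad` is NOT termwise (the self-similar term alone is `O(ρ)`): it is the
ALMOST-MONOTONICITY identity (critic V31b, price P5) — test the profile equation against `U φ_ρ` with a RADIAL cutoff `φ_ρ = φ(|y|/ρ)`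
(mandatory: then `(BU)·U = 0`, `(By)·∇φ_ρ = 0`, `tr B = 0` remove the rotation terms exactly) to get
`ν ∫|∇U|²φ_ρ = −(a/2)·ρ²·(A(ρ)/ρ)′ + E(ρ)`, `A(ρ) := ∫|U|²φ_ρ` (non-decreasing),
`E(ρ) = (ν/2)∫|U|²Δφ_ρ + ½∫|U|²U·∇φ_ρ + ∫(P − m_ρ)U·∇φ_ρ = O(1)` uniformly in `ρ ≥ 1` ONCE (i) and the CZ pressure improvement
`∫_{B_ρ}(P − m_ρ)² ≲ ρ` are in hand (raw `BMO₂` only gives `E = O(ρ)` and also breaks `hp`: so (i) + the CZ round PRECEDE (ii), and the CZ round is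
load-bearing twice); hence `(A/ρ)′ ≤ 2E/(aρ²)` (A/ρ almost non-increasing — this re-proves linear density from one scale) and
`∫_{ρ₀}^∞ ν G(ρ) ρ^{−2} dρ ≤ (a/2)·A(ρ₀)/ρ₀ + sup|E|/ρ₀ < ∞`, `G(ρ) := ∫_{B_ρ}|∇U|²`; under `λ(t) = (2a(−t))^{−1/2}`, `dt = dλ/(aλ³)`,
`|∇u(t)|²(x) = λ⁴|∇U|²(λe^{−θB}x)`: `∫∫_{Q₁}|∇u|² = a⁻¹ ∫_{λ(−1)}^∞ G(λ)λ^{−2} dλ < ∞` (`hgrad`), `henergy = sup_λ F(λ)/λ ≤ K₃`, and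
`hp = a⁻¹∫ H(λ)λ^{−3} dλ` with `H(λ) = ∫_{B_λ}|P − m_λ|^{3/2} ≤ |B_λ|^{1/4}(∫_{B_λ}(P − m_λ)²)^{3/4} ≲ λ^{3/2}` (a `t`-dependent constant `m` is a legal
pressure gauge); suitability on the
OPEN cylinder is classical (smooth solution below `t = 0`, tree `isClassicalNSSolutionOn_pvAnsatz_of_profile` pattern).  Sources: Tsai1998 Lemma 4.1
(ARMA 143 p. 46); CaffarelliKohnNirenberg1982 §2; tree `TsaiLocalEnergy.lean` (the fact's statement), `RieszPressure*` / `NecasRuzickaSverakRiesz` (CZ to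
reuse, not rebuild). [status: open] -/
theorem stub_localEnergyClass :
    ∀ (ν a : ℝ), 0 < ν → 0 < a → ∀ (B : E3 →L[ℝ] E3) (U : E3 → E3) (P : E3 → ℝ),
      ContDiff ℝ (⊤ : ℕ∞) U → ContDiff ℝ 2 P → (∀ x, inner ℝ (B x) x = 0) →
      Literature.Analysis.FluidPDE.VectorCalculus.IsDivFree U →
      (∀ y, -(ν • Laplacian.laplacian U y) + a • U y + a • fderiv ℝ U y y
        + (B (U y) - fderiv ℝ U y (B y)) + Literature.Analysis.FluidPDE.convect U U y
        + gradient P y = 0) →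
      (∃ M : ℝ, ∀ y, ‖U y‖ ≤ M) →
      ∀ K : ℝ,
      (∀ (z : E3) (ρ : ℝ), 0 < ρ → ∃ m : ℝ, ∫ y in Metric.ball z ρ, (P y - m) ^ 2 ≤ K * ρ ^ 3) →
      ∀ (β K₂ : ℝ), 1 < β →
      (∀ (z : E3) (ρ : ℝ), 1 ≤ ρ → ∫ y in Metric.ball z ρ, ‖U y‖ ^ 2 ≤ K₂ * ρ ^ (3 - β)) →
      ∀ (u : ℝ → E3 → E3), (∀ (t : ℝ) (x : E3), u t x = (Real.sqrt (2 * a * (0 - t)))⁻¹ • (NormedSpace.exp ((a⁻¹ * Real.log (Real.sqrt (2 * a * (0 - t)))⁻¹) • B)) (U ((Real.sqrt (2 * a * (0 - t)))⁻¹ • (NormedSpace.exp ((-(a⁻¹ * Real.log (Real.sqrt (2 * a * (0 - t)))⁻¹)) • B)) x))) →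
      (∃ K₃ : ℝ,
        (∀ (z : E3) (ρ : ℝ), 1 ≤ ρ → ∫ y in Metric.ball z ρ, ‖U y‖ ^ 2 ≤ K₃ * ρ ^ (3 - 2))) ∧
      (∃ p : ℝ → E3 → ℝ,
        IsSuitableWeakSolutionOn (parabolicCylinderOpens 1 ((0 : ℝ), (0 : E3))) ν 0 u p ∧
        (∃ C : ℝ≥0, ∀ᵐ t : ℝ, t ∈ Set.Ioo ((0 : ℝ) - 1 ^ 2) 0 →
          ∫⁻ x in Metric.ball (0 : E3) 1, ‖u t x‖ₑ ^ 2 ≤ C) ∧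
        (∃ G : ℝ → E3 → E3 →L[ℝ] E3, HasWeakSpatialGradientOn (parabolicCylinderOpens 1 ((0 : ℝ), (0 : E3))) u G ∧
          ∫⁻ z in parabolicCylinder 1 ((0 : ℝ), (0 : E3)), ENNReal.ofReal (frobeniusNormSq (G z.1 z.2)) < ⊤) ∧
        (∫⁻ z in parabolicCylinder 1 ((0 : ℝ), (0 : E3)), ‖p z.1 z.2‖ₑ ^ (3 / 2 : ℝ) < ⊤)) := by
  sorry

/-- **stub S3b — `stub_decayOfTopNull` (v2 split of S3, critic V31 P2; M — cheap, high value; no CZ).**  If the physical rotated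
self-similar field of a bounded smooth profile lies in the CKN/Tsai class on `Q₁(0,0)` (S3a's packaging, verbatim), then the profile DECAYS AT THE
TYPE-I RATE `|U(y)| ≤ K′/(1+|y|)`.  Plan: tree-PROVED `tsai1998_top_singular_null_holds` ⇒ `μH[1] {x ∈ B₁ : IsBackwardSingularPoint u (0,x)} = 0`;
ROTATING Cor. 4.3: if `|y_k||U(y_k)| > k` (so `|y_k| → ∞`), then for each `σ ∈ (0,1)` take `t_k ↑ 0` with `λ(t_k) = |y_k|/σ` and
`x_k = e^{θ(t_k)B} y_k / λ(t_k)`: `|x_k| = σ` (`e^{θB}` is an isometry for skew `B`: `inner (B x) x = 0`) and `|u(t_k,x_k)| = λ_k|U(y_k)| > k/σ`; an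
accumulation point `x*(σ)` on the sphere is backward-singular (continuity of `u` below `0` makes `u` essentially unbounded on every `Q_r(0,x*)`);
the 1-Lipschitz radial map `x ↦ ‖x‖` sends the top singular set onto `⊇ (0,1)`, so `μH[1] ≥ μH[1](0,1) > 0` (Mathlib
`LipschitzWith.hausdorffMeasure_image_le`, `Real.hausdorffMeasure`/`MeasureTheory.hausdorffMeasure_real`) — contradiction; hence
`sup |y||U(y)| < ∞`, and with `|U| ≤ M` one gets `|U(y)| ≤ 2 max(M, sup)/(1+|y|)`.  Why it might fail: it should not — the only delicate point is
the definition of `IsBackwardSingularPoint` (essential unboundedness on EVERY backward cylinder `Q_r(0,x*)`), met by continuity below the top.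
Sources: Tsai1998 Cor. 4.3 (p. 47); tree `TsaiTopSingularNullHolds.lean`, `LocalTypeI.lean` (`IsBackwardSingularPoint`). [status: open] -/
theorem stub_decayOfTopNull :
    ∀ (ν a : ℝ), 0 < ν → 0 < a → ∀ (B : E3 →L[ℝ] E3) (U : E3 → E3) (P : E3 → ℝ),
      ContDiff ℝ (⊤ : ℕ∞) U → ContDiff ℝ 2 P → (∀ x, inner ℝ (B x) x = 0) →
      Literature.Analysis.FluidPDE.VectorCalculus.IsDivFree U →
      (∀ y, -(ν • Laplacian.laplacian U y) + a • U y + a • fderiv ℝ U y y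
        + (B (U y) - fderiv ℝ U y (B y)) + Literature.Analysis.FluidPDE.convect U U y
        + gradient P y = 0) →
      (∃ M : ℝ, ∀ y, ‖U y‖ ≤ M) →
      ∀ (u : ℝ → E3 → E3), (∀ (t : ℝ) (x : E3), u t x = (Real.sqrt (2 * a * (0 - t)))⁻¹ • (NormedSpace.exp ((a⁻¹ * Real.log (Real.sqrt (2 * a * (0 - t)))⁻¹) • B)) (U ((Real.sqrt (2 * a * (0 - t)))⁻¹ • (NormedSpace.exp ((-(a⁻¹ * Real.log (Real.sqrt (2 * a * (0 - t)))⁻¹)) • B)) x))) →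
      (∃ p : ℝ → E3 → ℝ,
        IsSuitableWeakSolutionOn (parabolicCylinderOpens 1 ((0 : ℝ), (0 : E3))) ν 0 u p ∧
        (∃ C : ℝ≥0, ∀ᵐ t : ℝ, t ∈ Set.Ioo ((0 : ℝ) - 1 ^ 2) 0 →
          ∫⁻ x in Metric.ball (0 : E3) 1, ‖u t x‖ₑ ^ 2 ≤ C) ∧
        (∃ G : ℝ → E3 → E3 →L[ℝ] E3, HasWeakSpatialGradientOn (parabolicCylinderOpens 1 ((0 : ℝ), (0 : E3))) u G ∧
          ∫⁻ z in parabolicCylinder 1 ((0 : ℝ), (0 : E3)), ENNReal.ofReal (frobeniusNormSq (G z.1 z.2)) < ⊤) ∧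
        (∫⁻ z in parabolicCylinder 1 ((0 : ℝ), (0 : E3)), ‖p z.1 z.2‖ₑ ^ (3 / 2 : ℝ) < ⊤)) →
      ∃ K' : ℝ, ∀ y, ‖U y‖ ≤ K' / (1 + ‖y‖) := by
  sorry

/-- **Glue (PROVED): S3a ∧ S3b ⟹ S3** (`stub_typeIDecayOfLocalEnergy` of v1, now a theorem of the two halves; v1's probes on S3 stay valid
for the conjunction). -/
theorem typeIDecay_of
    (h3a : ∀ (ν a : ℝ), 0 < ν → 0 < a → ∀ (B : E3 →L[ℝ] E3) (U : E3 → E3) (P : E3 → ℝ),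
        ContDiff ℝ (⊤ : ℕ∞) U → ContDiff ℝ 2 P → (∀ x, inner ℝ (B x) x = 0) →
        Literature.Analysis.FluidPDE.VectorCalculus.IsDivFree U →
        (∀ y, -(ν • Laplacian.laplacian U y) + a • U y + a • fderiv ℝ U y y
          + (B (U y) - fderiv ℝ U y (B y)) + Literature.Analysis.FluidPDE.convect U U y
          + gradient P y = 0) →
        (∃ M : ℝ, ∀ y, ‖U y‖ ≤ M) →
        ∀ K : ℝ,
        (∀ (z : E3) (ρ : ℝ), 0 < ρ → ∃ m : ℝ, ∫ y in Metric.ball z ρ, (P y - m) ^ 2 ≤ K * ρ ^ 3) →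
        ∀ (β K₂ : ℝ), 1 < β →
        (∀ (z : E3) (ρ : ℝ), 1 ≤ ρ → ∫ y in Metric.ball z ρ, ‖U y‖ ^ 2 ≤ K₂ * ρ ^ (3 - β)) →
        ∀ (u : ℝ → E3 → E3), (∀ (t : ℝ) (x : E3), u t x = (Real.sqrt (2 * a * (0 - t)))⁻¹ • (NormedSpace.exp ((a⁻¹ * Real.log (Real.sqrt (2 * a * (0 - t)))⁻¹) • B)) (U ((Real.sqrt (2 * a * (0 - t)))⁻¹ • (NormedSpace.exp ((-(a⁻¹ * Real.log (Real.sqrt (2 * a * (0 - t)))⁻¹)) • B)) x))) →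
        (∃ K₃ : ℝ,
          (∀ (z : E3) (ρ : ℝ), 1 ≤ ρ → ∫ y in Metric.ball z ρ, ‖U y‖ ^ 2 ≤ K₃ * ρ ^ (3 - 2))) ∧
        (∃ p : ℝ → E3 → ℝ,
          IsSuitableWeakSolutionOn (parabolicCylinderOpens 1 ((0 : ℝ), (0 : E3))) ν 0 u p ∧
          (∃ C : ℝ≥0, ∀ᵐ t : ℝ, t ∈ Set.Ioo ((0 : ℝ) - 1 ^ 2) 0 →
            ∫⁻ x in Metric.ball (0 : E3) 1, ‖u t x‖ₑ ^ 2 ≤ C) ∧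
          (∃ G : ℝ → E3 → E3 →L[ℝ] E3, HasWeakSpatialGradientOn (parabolicCylinderOpens 1 ((0 : ℝ), (0 : E3))) u G ∧
            ∫⁻ z in parabolicCylinder 1 ((0 : ℝ), (0 : E3)), ENNReal.ofReal (frobeniusNormSq (G z.1 z.2)) < ⊤) ∧
          (∫⁻ z in parabolicCylinder 1 ((0 : ℝ), (0 : E3)), ‖p z.1 z.2‖ₑ ^ (3 / 2 : ℝ) < ⊤)))
    (h3b : ∀ (ν a : ℝ), 0 < ν → 0 < a → ∀ (B : E3 →L[ℝ] E3) (U : E3 → E3) (P : E3 → ℝ),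
        ContDiff ℝ (⊤ : ℕ∞) U → ContDiff ℝ 2 P → (∀ x, inner ℝ (B x) x = 0) →
        Literature.Analysis.FluidPDE.VectorCalculus.IsDivFree U →
        (∀ y, -(ν • Laplacian.laplacian U y) + a • U y + a • fderiv ℝ U y y
          + (B (U y) - fderiv ℝ U y (B y)) + Literature.Analysis.FluidPDE.convect U U y
          + gradient P y = 0) →
        (∃ M : ℝ, ∀ y, ‖U y‖ ≤ M) →
        ∀ (u : ℝ → E3 → E3), (∀ (t : ℝ) (x : E3), u t x = (Real.sqrt (2 * a * (0 - t)))⁻¹ • (NormedSpace.exp ((a⁻¹ * Real.log (Real.sqrt (2 * a * (0 - t)))⁻¹) • B)) (U ((Real.sqrt (2 * a * (0 - t)))⁻¹ • (NormedSpace.exp ((-(a⁻¹ * Real.log (Real.sqrt (2 * a * (0 - t)))⁻¹)) • B)) x))) →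
        (∃ p : ℝ → E3 → ℝ,
          IsSuitableWeakSolutionOn (parabolicCylinderOpens 1 ((0 : ℝ), (0 : E3))) ν 0 u p ∧
          (∃ C : ℝ≥0, ∀ᵐ t : ℝ, t ∈ Set.Ioo ((0 : ℝ) - 1 ^ 2) 0 →
            ∫⁻ x in Metric.ball (0 : E3) 1, ‖u t x‖ₑ ^ 2 ≤ C) ∧
          (∃ G : ℝ → E3 → E3 →L[ℝ] E3, HasWeakSpatialGradientOn (parabolicCylinderOpens 1 ((0 : ℝ), (0 : E3))) u G ∧
            ∫⁻ z in parabolicCylinder 1 ((0 : ℝ), (0 : E3)), ENNReal.ofReal (frobeniusNormSq (G z.1 z.2)) < ⊤) ∧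
          (∫⁻ z in parabolicCylinder 1 ((0 : ℝ), (0 : E3)), ‖p z.1 z.2‖ₑ ^ (3 / 2 : ℝ) < ⊤)) →
        ∃ K' : ℝ, ∀ y, ‖U y‖ ≤ K' / (1 + ‖y‖)) :
    ∀ (ν a : ℝ), 0 < ν → 0 < a → ∀ (B : E3 →L[ℝ] E3) (U : E3 → E3) (P : E3 → ℝ),
      ContDiff ℝ (⊤ : ℕ∞) U → ContDiff ℝ 2 P → (∀ x, inner ℝ (B x) x = 0) →
      Literature.Analysis.FluidPDE.VectorCalculus.IsDivFree U →
      (∀ y, -(ν • Laplacian.laplacian U y) + a • U y + a • fderiv ℝ U y y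
        + (B (U y) - fderiv ℝ U y (B y)) + Literature.Analysis.FluidPDE.convect U U y
        + gradient P y = 0) →
      (∃ M : ℝ, ∀ y, ‖U y‖ ≤ M) →
      ∀ K : ℝ,
      (∀ (z : E3) (ρ : ℝ), 0 < ρ → ∃ m : ℝ, ∫ y in Metric.ball z ρ, (P y - m) ^ 2 ≤ K * ρ ^ 3) →
      ∀ (β K₂ : ℝ), 1 < β →
      (∀ (z : E3) (ρ : ℝ), 1 ≤ ρ → ∫ y in Metric.ball z ρ, ‖U y‖ ^ 2 ≤ K₂ * ρ ^ (3 - β)) →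
      ∃ K' : ℝ, ∀ y, ‖U y‖ ≤ K' / (1 + ‖y‖) := by
  intro ν a hν ha B U P hU hP hB hdiv heq hbdd K hbmo β K₂ hβ hdens
  obtain ⟨-, hcls⟩ := h3a ν a hν ha B U P hU hP hB hdiv heq hbdd K hbmo β K₂ hβ hdens _ (fun t x => rfl)
  exact h3b ν a hν ha B U P hU hP hB hdiv heq hbdd _ (fun t x => rfl) hcls

/-- **stub R1 — `stub_pineauVicolConjecture` (DECLARED RESIDUAL = Pineau–Vicol Conjecture 1.1 AS PRINTED, profile form, printed frame
`(ν, a, B) = (1, ½, αJ)`, `α ≠ 0`, `J = rotGen`; XL, named open problem) — VERBATIM the residual of line `far_field_constancy` v2 (same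
wall, met by a different technique: this line makes the wall the WHOLE of the crux).**  Decided in print at extreme rates (PineauVicol2026
Thm 1.4; tree fact `pineauVicol2026_rss_liouville`); open at `|α| ≈ 1`.  Why it might fail: a genuine rotated self-similar blow-up profile
at intermediate rotation rate (none known).  Sources: PineauVicol2026 Conj. 1.1, Thm 1.4 (arXiv:2607.09619); Tsai1998 Thm 1. [status: open] -/
theorem stub_pineauVicolConjecture :
    ∀ α : ℝ, α ≠ 0 →
      ∀ (U : E3 → E3) (P : E3 → ℝ),
      ContDiff ℝ (⊤ : ℕ∞) U → ContDiff ℝ 2 P →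
      Literature.Analysis.FluidPDE.VectorCalculus.IsDivFree U →
      (∀ y, α • (rotGen (U y) - fderiv ℝ U y (rotGen y)) + (1 / 2 : ℝ) • U y
        + (1 / 2 : ℝ) • fderiv ℝ U y y - Laplacian.laplacian U y
        + Literature.Analysis.FluidPDE.convect U U y + gradient P y = 0) →
      (∃ K : ℝ, ∀ y, ‖U y‖ ≤ K / (1 + ‖y‖)) →
      ∀ y, U y = 0 := by
  sorry

/-- **Composition, part 1 (kernel-checked): S1, S2, S3 and the general-frame decaying Liouville (R1 through the landed
`decayingRotatedLiouville_of_pineauVicolFrame`) ⟹ bounded rotated-profile Liouville `X`** (the right-hand side of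
`noCoRotatingCore_iff_rotatedProfileLiouville`).  Recentred profile `V = U(· + y₀) − b` is bounded with `BMO₂` pressure (S1), has
sub-volume density (S2), decays at the Type-I rate (S3), vanishes (R1); undo the translation. -/
theorem rotatedProfileLiouville_of
    (h₁ : ∀ (ν a : ℝ), 0 < ν → 0 < a → ∀ (B : E3 →L[ℝ] E3) (U : E3 → E3) (P : E3 → ℝ),
        ContDiff ℝ (⊤ : ℕ∞) U → ContDiff ℝ 2 P → (∀ x, inner ℝ (B x) x = 0) →
        Literature.Analysis.FluidPDE.VectorCalculus.IsDivFree U →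
        (∀ y, -(ν • Laplacian.laplacian U y) + a • U y + a • fderiv ℝ U y y
          + (B (U y) - fderiv ℝ U y (B y)) + Literature.Analysis.FluidPDE.convect U U y
          + gradient P y = 0) →
        (∃ M : ℝ, ∀ y, ‖U y‖ ≤ M) →
        ∃ (y₀ b : E3) (P' : E3 → ℝ) (K : ℝ),
          ContDiff ℝ (⊤ : ℕ∞) (fun y => U (y + y₀) - b) ∧ ContDiff ℝ 2 P' ∧
          Literature.Analysis.FluidPDE.VectorCalculus.IsDivFree (fun y => U (y + y₀) - b) ∧
          (∀ y, -(ν • Laplacian.laplacian (fun y => U (y + y₀) - b) y) + a • (fun y => U (y + y₀) - b) y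
            + a • fderiv ℝ (fun y => U (y + y₀) - b) y y
            + (B ((fun y => U (y + y₀) - b) y) - fderiv ℝ (fun y => U (y + y₀) - b) y (B y))
            + Literature.Analysis.FluidPDE.convect (fun y => U (y + y₀) - b) (fun y => U (y + y₀) - b) y
            + gradient P' y = 0) ∧
          (∃ M' : ℝ, ∀ y, ‖(fun y => U (y + y₀) - b) y‖ ≤ M') ∧
          (∀ (z : E3) (ρ : ℝ), 0 < ρ → ∃ m : ℝ, ∫ y in Metric.ball z ρ, (P' y - m) ^ 2 ≤ K * ρ ^ 3))
    (h₂ : ∀ (ν a : ℝ), 0 < ν → 0 < a → ∀ (B : E3 →L[ℝ] E3) (U : E3 → E3) (P : E3 → ℝ),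
        ContDiff ℝ (⊤ : ℕ∞) U → ContDiff ℝ 2 P → (∀ x, inner ℝ (B x) x = 0) →
        Literature.Analysis.FluidPDE.VectorCalculus.IsDivFree U →
        (∀ y, -(ν • Laplacian.laplacian U y) + a • U y + a • fderiv ℝ U y y
          + (B (U y) - fderiv ℝ U y (B y)) + Literature.Analysis.FluidPDE.convect U U y
          + gradient P y = 0) →
        (∃ M : ℝ, ∀ y, ‖U y‖ ≤ M) →
        ∀ K : ℝ,
        (∀ (z : E3) (ρ : ℝ), 0 < ρ → ∃ m : ℝ, ∫ y in Metric.ball z ρ, (P y - m) ^ 2 ≤ K * ρ ^ 3) →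
        ∃ (β K₂ : ℝ), 1 < β ∧
          (∀ (z : E3) (ρ : ℝ), 1 ≤ ρ → ∫ y in Metric.ball z ρ, ‖U y‖ ^ 2 ≤ K₂ * ρ ^ (3 - β)))
    (h₃ : ∀ (ν a : ℝ), 0 < ν → 0 < a → ∀ (B : E3 →L[ℝ] E3) (U : E3 → E3) (P : E3 → ℝ),
        ContDiff ℝ (⊤ : ℕ∞) U → ContDiff ℝ 2 P → (∀ x, inner ℝ (B x) x = 0) →
        Literature.Analysis.FluidPDE.VectorCalculus.IsDivFree U →
        (∀ y, -(ν • Laplacian.laplacian U y) + a • U y + a • fderiv ℝ U y y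
          + (B (U y) - fderiv ℝ U y (B y)) + Literature.Analysis.FluidPDE.convect U U y
          + gradient P y = 0) →
        (∃ M : ℝ, ∀ y, ‖U y‖ ≤ M) →
        ∀ K : ℝ,
        (∀ (z : E3) (ρ : ℝ), 0 < ρ → ∃ m : ℝ, ∫ y in Metric.ball z ρ, (P y - m) ^ 2 ≤ K * ρ ^ 3) →
        ∀ (β K₂ : ℝ), 1 < β →
        (∀ (z : E3) (ρ : ℝ), 1 ≤ ρ → ∫ y in Metric.ball z ρ, ‖U y‖ ^ 2 ≤ K₂ * ρ ^ (3 - β)) →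
        ∃ K' : ℝ, ∀ y, ‖U y‖ ≤ K' / (1 + ‖y‖))
    (hR : ∀ (ν a : ℝ), 0 < ν → 0 < a → ∀ (B : E3 →L[ℝ] E3) (U : E3 → E3) (P : E3 → ℝ),
        ContDiff ℝ (⊤ : ℕ∞) U → ContDiff ℝ 2 P → (∀ x, inner ℝ (B x) x = 0) →
        Literature.Analysis.FluidPDE.VectorCalculus.IsDivFree U →
        (∀ y, -(ν • Laplacian.laplacian U y) + a • U y + a • fderiv ℝ U y y
          + (B (U y) - fderiv ℝ U y (B y)) + Literature.Analysis.FluidPDE.convect U U y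
          + gradient P y = 0) →
        (∃ K : ℝ, ∀ y, ‖U y‖ ≤ K / (1 + ‖y‖)) →
        ∀ y, U y = 0) :
    ∀ (ν a : ℝ), 0 < ν → 0 < a → ∀ (B : E3 →L[ℝ] E3) (U : E3 → E3) (P : E3 → ℝ),
      ContDiff ℝ (⊤ : ℕ∞) U → ContDiff ℝ 2 P → (∀ x, inner ℝ (B x) x = 0) →
      Literature.Analysis.FluidPDE.VectorCalculus.IsDivFree U →
      (∀ y, -(ν • Laplacian.laplacian U y) + a • U y + a • fderiv ℝ U y y
        + (B (U y) - fderiv ℝ U y (B y)) + Literature.Analysis.FluidPDE.convect U U y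
        + gradient P y = 0) →
      (∃ M : ℝ, ∀ y, ‖U y‖ ≤ M) →
      ∃ b : E3, ∀ y, U y = b := by
  intro ν a hν ha B U P hU hP hB hdiv heq hbdd
  obtain ⟨y₀, b, P', K, hV, hP', hdivV, heqV, hbddV, hBMO⟩ := h₁ ν a hν ha B U P hU hP hB hdiv heq hbdd
  obtain ⟨β, K₂, hβ, hdens⟩ := h₂ ν a hν ha B (fun y => U (y + y₀) - b) P' hV hP' hB hdivV heqV hbddV K hBMO
  obtain ⟨K', hdec⟩ := h₃ ν a hν ha B (fun y => U (y + y₀) - b) P' hV hP' hB hdivV heqV hbddV K hBMO β K₂ hβ hdens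
  have hzero : ∀ y, (fun y => U (y + y₀) - b) y = 0 :=
    hR ν a hν ha B (fun y => U (y + y₀) - b) P' hV hP' hB hdivV heqV ⟨K', hdec⟩
  refine ⟨b, fun y => ?_⟩
  have h := hzero (y - y₀)
  simp only [sub_add_cancel] at h
  exact sub_eq_zero.mp h

/-- **Composition, part 2 (kernel-checked): the four stubs ⟹ the crux `CoriolisHead.NoCoRotatingCore` BY NAME**, through the landed
equivalence `noCoRotatingCore_iff_rotatedProfileLiouville` (route CoriolisHead's PROVED `CounterRotatingLiouville`, stmt-22677) and the
landed frame reduction `decayingRotatedLiouville_of_pineauVicolFrame` (p605289).  `NoCoRotatingCore`, `SpiralScalingLiouville` and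
Navier–Stokes regularity are NOT proved: S1, S2, S3a, S3b are open lemmas and R1 is the printed open problem.  No hypotheses; the stubs enter by
name (the form a skeleton check would read — NOT run on this crux, KEY-NS #87). -/
theorem NoCoRotatingCore_of : CoriolisHead.NoCoRotatingCore :=
  noCoRotatingCore_iff_rotatedProfileLiouville.mpr
    (rotatedProfileLiouville_of stub_driftNormalForm stub_densityBootstrap (typeIDecay_of stub_localEnergyClass stub_decayOfTopNull)
      (decayingRotatedLiouville_of_pineauVicolFrame stub_pineauVicolConjecture))

end Summit.NavierStokesRegularity.NavierStokesRegularity.Cruxes.NoCoRotatingCore.LocalEnergyRescue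

end
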